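import Literature.MathematicalPhysics.QuantumFieldTheory.Balaban1983to89.B1Ineq227BackgroundTorus
import Literature.MathematicalPhysics.QuantumFieldTheory.Balaban1983to89.B1Ineq233LowerBackgroundTorus
import Literature.MathematicalPhysics.QuantumFieldTheory.Balaban1983to89.B1Ineq234ZeroFieldRegionUniform

/-!
# `Balaban1983to89.B1Ineq234BackgroundTorus` — T. Bałaban, *(Higgs)₂,₃ quantum fields in a finite volume. I. A lower bound*,
# Commun. Math. Phys. **85** (1982) 603–626 [Balaban1982Higgs1], PROPOSITION 2.3 (2.34) p. 611 / (2.36) p. 612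
# **AT THE REGULAR BACKGROUND `A = A^{(k),ε} ≠ 0` OF (3.29), `Ω = T_ε`, EVERY LEVEL `1 ≦ k < K_P`, EVERY `Λ ⊂ T^{(k)}`** on
# the concrete (Higgs)₂,₃ carrier: `|C^{(k),L^kε}_Λ(T_ε, A^{(k),ε}; p, q)| ≦ (L^kε)²·c₁·e^{−δ₁|x_p − x_q|}` and
# `|δC^{(k),L^kε}_Λ(T_ε, A^{(k),ε}; p, q)| ≦ (L^kε)²·c₁·e^{−δ₁(|x_p − x_q| + dist(x_p,Λᶜ) + dist(x_q,Λᶜ))}` with `(c₁, δ₁)`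
# INDEPENDENT of `k`, `ε`, the volume, `Λ` and `A` (`|A| ≦ r`, `r·L^kε ≦ c_A`) — r14 g7's engine
# `B1Ineq234Concrete.ineq234/236_concrete_of_deltaKA` ([Balaban1983RegularityDecay] Sect. 5) fed with the two `A ≠ 0` inputs of this
# generation: (2.33)ₗ at `A^{(k),ε}` (`B1Ineq233LowerBackgroundTorus.ineq233_lower_bgVec_torus`, p317716) and (2.27) at `A^{(k),ε}`
# (`B1Ineq227BackgroundTorus.ineq227_bgVec_torus`, p316504), the scale uniformized by r14 g9's `decay_transfer`.
# The first `A ≠ 0` instance of (2.34)/(2.36) on this carrier.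

statement-level skeleton of published theorems with citation tags; proofs where landed; nothing here is a claim about the Yang–Mills mass gap

PDF held: `paper:balaban1982-cmp85-higgs23-i` (journal page = PDF page + 602): p. 611 [PDF 9] (Prop. 2.3 (2.33)–(2.35); text layer
`p0009.txt` l. 24–37 read by this seat), p. 612 [PDF 10] ((2.36)), p. 610 [PDF 8] ((2.23)), p. 617 [PDF 15] ((3.29));
`paper:balaban1983-cmp89-regularity-decay` (journal = PDF + 570): pp. 593–594 [PDF 23–24] (§5 (5.2)–(5.6), the Sect.-5 Theorem;
render `…-p023-x2.png` read by this seat).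

CITATION HEADER (lean-in-tree rule).  Cell `lit-balaban` (HOME `run/shared/lean/pub/lit-balaban/`), reader/typer seat **r14**
gen 13 (unit `lit-balaban-r14`, B1 fold owner; TAKING line HOME/STATUS.md 2026-08-22T03:19:04Z, free-target protocol
G.5-34(d)), SKELETON row **B1.Prop2.3** (members (2.34), (2.36); decls of record `B1.Prop23Literal`/`Prop23Intended`; head
`proved …` led by p17's `A ≠ 0` model instances on the b04 carrier `B4Prop23RegularFamily`; on THIS carrier (2.34)/(2.36) were
available at `A = 0` only — r14 g7 `B1Ineq233LowerZeroFieldTorus.ineq234/236_zeroField_of_sep`, p14 g10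
`B1Cor23DictZeroFieldTorus`, r14 g9 `B1Ineq234ZeroFieldRegionUniform`), twin row **B4.Prop2.3** / B4 Sect. 5 (owner r01);
referee ref-1.  USED BY NAME, never restated: r14 g7 `B1Ineq234Concrete.{ineq234_concrete_of_deltaKA, ineq236_concrete_of_deltaKA,
profile, profile_nonneg', nCol, distC, distC_nonneg}` (p255380/p256107/p256607), `B4Sect5Torus.{cSt, dSt, cSt_pos, dSt_pos,
profile_nonneg}` (pv09/p17), r14 g9 `B1Ineq234ZeroFieldRegionUniform.{decay_transfer, profile_anti}` (p302810), r14 g13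
`B1Ineq227BackgroundTorus.ineq227_bgVec_torus` (p316504; from p35 g9 `B1Ineq225DecayBackgroundTorus`) and
`B1Ineq233LowerBackgroundTorus.ineq233_lower_bgVec_torus` (p317716; from p23 g11 `B2Ineq329RegularField` + p35 g8
`B1Ineq225BackgroundTorus`), p35 g8 `B1Ineq225BackgroundTorus.three_half_le_sites`, `B1TorusCubeCover.half`,
`B1Ineq233LowerZeroField.mesh_succ`, the typer's `HiggsCondCov232.{condCov232, deltaCov235}` ((2.32), (2.35)),
`B1Eq230FluctCov.{mat, Ix}`, p23/r15's `B1Eq31Concrete.bgVec`, `B1Eq211ZeroFieldTorus.Shape`.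

WHAT IS PRINTED (verbatim).  [B1] p. 611 [PDF 9]: *"we will need the covariances which are obtained by conditioning with respect to
some set Λ ⊂ Ω^{(k)}. … C^{(k)}_Λ(Ω, A) = ((aL^{−2}P(A) + Δ^{(k)}(Ω, A))↾_Λ)^{−1}. (2.32) Here we will assume that the set Λ is a
union of big blocks of T^{(k)}_1. Proposition 2.3. If a configuration A is regular on Ω in the sense defined in Proposition 2.1,
then there exist positive constants δ₀, c₀, γ₀, γ₁ dependent on d and a, and independent of A, k, Ω and Λ, such that γ₀I ≦
aL^{−2}P(A) + Δ^{(k)}(Ω, A) ≦ γ₁I, (2.33) |C^{(k)}_Λ(Ω, A; x, x′)| ≦ c₀exp(−δ₀|x − x′|), x, x′ ∈ Λ. (2.34) In particular the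
above inequality holds for C^{(k)}(Ω, A). Putting δC^{(k)}_Λ(Ω, A) = C^{(k)}_Λ(Ω, A) − C^{(k)}(Ω, A), (2.35)"*; p. 612 [PDF 10]:
*"|δC^{(k)}_Λ(Ω, A; x, x′)| ≦ c₀exp(−δ₀(|x − x′| + dist(x, Λᶜ) + dist(x′, Λᶜ))), x, x′ ∈ Λ. (2.36)"*.  [B4] p. 593 [PDF 23]:
*"There is another way of proving Proposition I.2.3, relying on a general theorem concerning inverses to some unit lattice
operators. … Finally Corollary 2.3 implies that the considered operator is short-ranged in the sense that for some δ₀ > 0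
|(Δ^{(k)}(Ω, A) + aL^{−2}P(A))(x, x′)| ≦ c₀e^{−δ₀|x−x′|}, x, x′ ∈ Ω^{(k)}, (5.4)"*; p. 594 [PDF 24]: *"From these properties it
follows that Proposition I.2.3 is a consequence of the following Theorem"*.

DICTIONARY (as in r14 g7's `B1Ineq234Concrete` / g9's `B1Ineq234ZeroFieldRegionUniform` and g13's two background files; NO
rescaling to the unit lattice).  `Ω = T_ε` (`Finset.univ`); `A` regular ↦ the background `A^{(k),ε} = bgVec μ₀² a k A` of (3.29)
with `|A(x)| ≦ r`, «e(L^kε) sufficiently small» ↦ `r·L^kε ≦ c_A(K₀)` (the minimum of the thresholds of p316504 and p317716), «M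
sufficiently large» ↦ the cube size `K₀ ≥ K₀min` of p35's torus random walk (`K₀ ∣ M`, `3·L^kK₀ ≦ |T_ε|_μ`);
`C^{(k)}_Λ(Ω, A)` ↦ `HiggsCondCov232.condCov232 C univ A^{(k),ε} m² a k Λ` (the restricted inverse (2.32) of r14's `precOpA` on
the `L^kε`-lattice — it carries the factor `(L^kε)²`; the printed unit-lattice kernel is the case `L^kε = 1`); `δC^{(k)}_Λ` ↦
`deltaCov235`; `|x − x′|`, `dist(x, Λᶜ)` ↦ (1.3) `Site.tdist`, `B1Ineq234Concrete.distC`; the printed `(c₀, δ₀)` of (2.34)/(2.36)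
↦ `(c₁, δ₁)(K₀) = (cSt, dSt)(N·K_d; γ, c_U(K₀), δ₀(K₀))` with `γ` the (2.33)ₗ-constant of p317716, `δ₀(K₀)` the (2.27)-rate of
p316504, `c_U = aL^{−2}e^{δ₀(L−1)} + c` (`c` the (2.27)-constant) — functions of `(d, N, L, a, μ₀², m², e, K₀)` only.

WHAT THIS FILE PROVES (kernel-checked, zero `sorry`, standard axioms; theorems only — no definition, no `Prop`-valued fact):
* §1 `two_le_sitesPerDir` (`|T^{(k)}|_μ = 2L^{K−k}ML′_μ ≧ 2`: the no-wrap hypothesis of p317716 is automatic).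
* §2 **`ineq234_236_bgVec_torus`** (ONE theorem, the conjunction (2.34) ∧ (2.36); v1.1 docfix ref-4 S-B1-g38-1 — v1.0 listed it under
  the two names `ineq234_bgVec_torus` / `ineq236_bgVec_torus`): for `d ≧ 1`, odd `L > 1`, `a, μ₀², m² > 0`, `N`, `(e, q)` there are
  `K₀min` and functions `c_A, c₁, δ₁ : ℕ → ℝ_{>0}` such that for `K₀ ≧ K₀min`, on every torus of the sub-family (`Shape`) with
  `K₀ ∣ M`, at every level `1 ≦ k < K_P` with `3·L^kK₀ ≦ |T_ε|_μ`, `L^kε ≦ 1`, for every `r` with `r·L^kε ≦ c_A(K₀)`, every block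
  field `A` on `T^{(k)}` with `|A(x)| ≦ r`, every `Λ ⊂ T^{(k)}` and all coordinate indices `p, q` over `Λ`:
  `|C^{(k),L^kε}_Λ(T_ε, A^{(k),ε})(p,q)| ≦ (L^kε)²c₁(K₀)e^{−δ₁(K₀)|x_p − x_q|}` and
  `|δC^{(k),L^kε}_Λ(T_ε, A^{(k),ε})(p,q)| ≦ (L^kε)²c₁(K₀)e^{−δ₁(K₀)(|x_p − x_q| + dist(x_p,Λᶜ) + dist(x_q,Λᶜ))}`;
  `_std` variants with the cube condition «`K₀ ∣ M`, `3K₀ ≦ 2M`».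
HONEST SCOPE.  (i) `Ω = T_ε`, `1 ≦ k < K_P`, the background `A^{(k),ε}` of (3.29) only (the generic regular `A` of the print is
not claimed); `Λ ⊂ T^{(k)}` arbitrary (STRONGER than the printed «union of big blocks», which is not needed by the Sect.-5 route).
(ii) Constants: explicit but crude (`B4Sect5Torus`), depending on `(d, N, L, a, μ₀², m², e)` AND the cube size `K₀` (the print's
«M»; *"δ₀ … depending on d, a, M"* in Prop. 2.1 — letters by the page image `…-I-p008-x2.png`, the text layer swaps `a`/`α`; v1.2 doc-only
re-key, referee note S-B1-g39-2) — weaker than the printed «dependent on d and a»; the factor `(L^kε)²` is the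
unit-lattice rescaling (2.31) of the covariance.  (iii) (2.38) (`Ω ⊂ Ω₀`) is not here (`Ω = T_ε` has no sub-region pair on this
route).  (iv) Value = kernel certificate that the printed Sect.-5 mechanism closes (2.34)/(2.36) at the first `A ≠ 0` background
of the (Higgs)₂,₃ construction from the cell's own (2.27)/(2.33)ₗ instances; NOT summit progress.  Unit `lit-balaban-r14-g13`
(literature-prover-lit-balaban-r14-g13-0); HOME/FILED.md records the proposal.
-/

noncomputable section

open scoped BigOperators InnerProductSpace

namespace Literature.MathematicalPhysics.QuantumFieldTheory.Balaban1983to89.B1Ineq234BackgroundTorus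

open HiggsLattice HiggsCovariance HiggsCovariancePos B1Eq230FluctCov HiggsCondCov232
open B3MultiscaleFields (toSite)
open B1Eq31Concrete (bgVec)
open B1Eq211ZeroFieldTorus (Shape)
open B1TorusCubeCover (half)
open B1Ineq225BackgroundTorus (three_half_le_sites)
open B1Ineq233LowerZeroField (mesh_succ)
open B1Ineq234Concrete (profile profile_nonneg' nCol distC distC_nonneg ineq234_concrete_of_deltaKA ineq236_concrete_of_deltaKA)
open B4Sect5Torus (cSt dSt cSt_pos dSt_pos profile_nonneg)
open B1Ineq234ZeroFieldRegionUniform (decay_transfer profile_anti)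
open B1Ineq227BackgroundTorus (ineq227_bgVec_torus)
open B1Ineq233LowerBackgroundTorus (ineq233_lower_bgVec_torus)

variable {P : HiggsLattice.Params} {N : ℕ}

/-! ## §1 The tori of the model have at least two sites per direction at every level -/

/-- `|T^{(k)}_{L^kε}|_μ = 2L^{K−k}ML′_μ ≧ 2` ((1.2): *"K, L, M, L′_μ are some positive integers"*). [cite: Balaban1982Higgs1, (1.2) p.604] -/
theorem two_le_sitesPerDir (P : HiggsLattice.Params) (k : ℕ) (μ : Fin P.d) : 2 ≤ P.sitesPerDir k μ := by
  unfold HiggsLattice.Params.sitesPerDir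
  have h : 0 < P.L ^ (P.K - k) * P.M * P.Lp μ := Nat.mul_pos (Nat.mul_pos (pow_pos P.hL _) P.hM) (P.hLp μ)
  omega

/-! ## §2 (2.34)/(2.36) at the background `A^{(k),ε}` on the whole torus, constants uniform in the scale -/

section Background

/-- `((L^kε)^{−2})^{−1} = (L^kε)²` and `(L^{k+1}ε)^{−2} = L^{−2}(L^kε)^{−2}`. [cite: Balaban1982Higgs1, (1.19) p.607] -/
theorem mesh_inv_sq_facts (P : HiggsLattice.Params) (k : ℕ) :
    ((P.mesh k)⁻¹ ^ 2)⁻¹ = P.mesh k ^ 2 ∧ (P.mesh (k + 1))⁻¹ ^ 2 = ((P.L : ℝ) ^ 2)⁻¹ * (P.mesh k)⁻¹ ^ 2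
      ∧ 1 ≤ (P.mesh k)⁻¹ ^ 2 ∨ ¬ P.mesh k ≤ 1 := by
  by_cases hs : P.mesh k ≤ 1
  · refine Or.inl ⟨by rw [inv_pow, inv_inv], by rw [mesh_succ k, mul_inv, mul_pow, inv_pow], ?_⟩
    rw [inv_pow]
    exact one_le_inv_iff₀.mpr ⟨pow_pos (P.mesh_pos k) 2, by nlinarith [P.mesh_pos k]⟩
  · exact Or.inr hs

/-- **PROPOSITION 2.3 (2.34) AND (2.36) AT THE REGULAR BACKGROUND `A^{(k),ε}` OF (3.29), `Ω = T_ε`, EVERY LEVEL `1 ≦ k < K_P`,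
EVERY `Λ ⊂ T^{(k)}`, SCALE-UNIFORM CONSTANTS** — the first `A ≠ 0` instance of (2.34)/(2.36) on the (Higgs)₂,₃ carrier.  For
`d ≧ 1`, odd `L > 1`, `a, μ₀², m² > 0`, `N`, `(e, q)`: there are `K₀min` and `c_A, c₁, δ₁ : ℕ → ℝ_{>0}` such that for every cube
size `K₀ ≧ K₀min`, on every torus of the sub-family with `K₀ ∣ M`, at every level `1 ≦ k < K_P` with `3·L^kK₀ ≦ |T_ε|_μ` and
`L^kε ≦ 1`, for every `r` with `r·L^kε ≦ c_A(K₀)`, every block field `A` on `T^{(k)}` with `|A(x)| ≦ r`, every `Λ` and all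
`p = (x, i)`, `q = (x′, i′)` with `x, x′ ∈ Λ`:
`|C^{(k),L^kε}_Λ(T_ε, A^{(k),ε})(p, q)| ≦ (L^kε)²·c₁(K₀)·e^{−δ₁(K₀)|x − x′|}` and
`|δC^{(k),L^kε}_Λ(T_ε, A^{(k),ε})(p, q)| ≦ (L^kε)²·c₁(K₀)·e^{−δ₁(K₀)(|x − x′| + dist(x,Λᶜ) + dist(x′,Λᶜ))}`
(`(c₁, δ₁) = (cSt, dSt)(N·K_d; γ, aL^{−2}e^{δ₀(L−1)} + c, δ₀)` from the (2.33)ₗ-constant `γ` of p317716 and the (2.27)-pair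
`(c, δ₀(K₀))` of p316504, by r14 g7's Sect.-5 engine and g9's scale transfer).
[cite: Balaban1982Higgs1, Prop. 2.3 (2.34) p.611, (2.36) p.612, (3.29) p.617] [cite: Balaban1983RegularityDecay, Sect. 5 (5.4)–(5.6) p.594] -/
theorem ineq234_236_bgVec_torus (d L : ℕ) (hd : 1 ≤ d) (hL : Odd L ∧ 1 < L) {a : ℝ} (ha : 0 < a) {mu0sq msq : ℝ}
    (hmu : 0 < mu0sq) (hmsq : 0 < msq) (N : ℕ) (C : ChargeData N) :
    ∃ K₀min : ℕ, ∃ cA c₁ δ₁ : ℕ → ℝ, (∀ K₀, 0 < cA K₀ ∧ 0 < c₁ K₀ ∧ 0 < δ₁ K₀) ∧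
      ∀ K₀ : ℕ, K₀min ≤ K₀ →
      ∀ (P : HiggsLattice.Params) (_S : Shape P), P.d = d → P.L = L → K₀ ∣ P.M →
      ∀ {k : ℕ}, 1 ≤ k → k < P.K → (∀ μ, 3 * half P k K₀ ≤ P.sitesPerDir 0 μ) → P.mesh k ≤ 1 →
      ∀ {r : ℝ}, r * P.mesh k ≤ cA K₀ →
      ∀ A : HiggsLattice.VecField P k, (∀ x, ‖toSite A x‖ ≤ r) →
        ∀ (Λ : Finset (HiggsLattice.Site P k)) {p q : HiggsLattice.Site P k × Ix N}, p.1 ∈ Λ → q.1 ∈ Λ →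
          |mat (condCov232 C Finset.univ (bgVec mu0sq a k A) msq a k Λ) p q| ≤
              P.mesh k ^ 2 * c₁ K₀ * Real.exp (-(δ₁ K₀ * (HiggsLattice.Site.tdist p.1 q.1 : ℝ)))
          ∧ |mat (deltaCov235 C Finset.univ (bgVec mu0sq a k A) msq a k Λ) p q| ≤
              P.mesh k ^ 2 * c₁ K₀ * Real.exp (-(δ₁ K₀ *
                ((HiggsLattice.Site.tdist p.1 q.1 : ℝ) + distC Λ p.1 + distC Λ q.1))) := by
  obtain ⟨c, hc, K₀min, cA, δ₀, hcδ, hΔ⟩ := ineq227_bgVec_torus d L hd hL ha hmu hmsq N C 1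
  obtain ⟨γ, hγ, cA', hcA', hlow⟩ := ineq233_lower_bgVec_torus d L hd hL ha hmu hmsq N C
  -- the uniform kernel constant `c_U(K₀) = aL^{-2}e^{δ₀(K₀)(L-1)} + c` and the model's profile `N·K_d`
  obtain ⟨cU, hcU⟩ : ∃ cU : ℕ → ℝ, cU = fun K₀ => a * ((L : ℝ) ^ 2)⁻¹ * Real.exp (δ₀ K₀ * ((L : ℝ) - 1)) + c :=
    ⟨_, rfl⟩
  have hcU0 : ∀ K₀, 0 ≤ cU K₀ := fun K₀ => by rw [hcU]; positivity
  refine ⟨K₀min, fun K₀ => min (cA K₀) cA',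
    fun K₀ => cSt (fun t => (nCol N : ℝ) * B4Sect5Proof.latticeConst d t) γ (cU K₀) (δ₀ K₀),
    fun K₀ => dSt (fun t => (nCol N : ℝ) * B4Sect5Proof.latticeConst d t) γ (cU K₀) (δ₀ K₀),
    fun K₀ => ⟨lt_min (hcδ K₀).1 hcA', cSt_pos _ _ _ hγ,
      dSt_pos (profile_nonneg d (nCol N)) hγ (hcU0 K₀) (hcδ K₀).2.1⟩, ?_⟩
  intro K₀ hK₀ P S hPd hPL hK₀M k hk1 hk hN3 hs r hr A hA Λ p q hp hq
  have hΔ' := hΔ K₀ hK₀ P S hPd hPL hK₀M hk1 hk.le hN3 hs (hr.trans (min_le_left _ _)) A hA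
  have hlow' := hlow P S hPd hPL hk1 hk (fun μ => two_le_sitesPerDir P (k + 1) μ) hs
    (hr.trans (min_le_right _ _)) A hA
  subst hPd hPL
  rcases mesh_inv_sq_facts P k with ⟨hsinv, hsucc, hs1⟩ | hns
  swap
  · exact absurd hs hns
  have hs0 : 0 < (P.mesh k)⁻¹ ^ 2 := by positivity
  have hδ0 := (hcδ K₀).2.1
  -- the kernel constant of (5.4): `a(L^{k+1}ε)^{-2}e^{δ₀(L-1)} + c(L^kε)^{-2} = c_U·(L^kε)^{-2}`
  have e : a * ((P.mesh (k + 1))⁻¹ ^ 2) * Real.exp (δ₀ K₀ * ((P.L : ℝ) - 1)) + c * (P.mesh k)⁻¹ ^ 2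
      = cU K₀ * (P.mesh k)⁻¹ ^ 2 := by
    rw [hsucc, hcU]; ring
  have ht : 0 ≤ (HiggsLattice.Site.tdist p.1 q.1 : ℝ) := Nat.cast_nonneg _
  have ht' : 0 ≤ (HiggsLattice.Site.tdist p.1 q.1 : ℝ) + distC Λ p.1 + distC Λ q.1 :=
    add_nonneg (add_nonneg ht (distC_nonneg Λ _)) (distC_nonneg Λ _)
  have hlow'' : ∀ f : ScalarField P k N, γ * (P.mesh k)⁻¹ ^ 2 * siteInner f f
      ≤ siteInner f (precOpA C Finset.univ (bgVec mu0sq a k A) msq a k f) := hlow'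
  have hΔ'' : ∀ p q : HiggsLattice.Site P k × Ix N,
      |mat (deltaKA C Finset.univ (bgVec mu0sq a k A) msq a k) p q|
        ≤ c * (P.mesh k)⁻¹ ^ 2 * Real.exp (-(δ₀ K₀ * (HiggsLattice.Site.tdist p.1 q.1 : ℝ))) := hΔ'
  constructor
  · have main := ineq234_concrete_of_deltaKA C Finset.univ (bgVec mu0sq a k A) msq a hk ha.le
      (mul_pos hγ hs0) (mul_pos hc hs0) hδ0 hlow'' hΔ'' Λ hp hq
    rw [e] at main
    have htr := decay_transfer (K := profile P N) profile_nonneg' profile_anti hγ (hcU0 K₀) le_rfl hδ0 hs1 ht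
    rw [hsinv] at htr
    exact main.trans (htr.trans_eq (by ring))
  · have main := ineq236_concrete_of_deltaKA C Finset.univ (bgVec mu0sq a k A) msq a hk ha.le
      (mul_pos hγ hs0) (mul_pos hc hs0) hδ0 hlow'' hΔ'' Λ hp hq
    rw [e] at main
    have htr := decay_transfer (K := profile P N) profile_nonneg' profile_anti hγ (hcU0 K₀) le_rfl hδ0 hs1 ht'
    rw [hsinv] at htr
    exact main.trans (htr.trans_eq (by ring))

/-- **(2.34)/(2.36) AT `A^{(k),ε}`, CUBE CONDITION «`K₀ ∣ M`, `3K₀ ≦ 2M`»** (then `3·L^kK₀ ≦ |T_ε|_μ` at every level, p35's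
`three_half_le_sites`). [cite: Balaban1982Higgs1, Prop. 2.3 (2.34) p.611, (2.36) p.612, (3.29) p.617] -/
theorem ineq234_236_bgVec_torus_std (d L : ℕ) (hd : 1 ≤ d) (hL : Odd L ∧ 1 < L) {a : ℝ} (ha : 0 < a) {mu0sq msq : ℝ}
    (hmu : 0 < mu0sq) (hmsq : 0 < msq) (N : ℕ) (C : ChargeData N) :
    ∃ K₀min : ℕ, ∃ cA c₁ δ₁ : ℕ → ℝ, (∀ K₀, 0 < cA K₀ ∧ 0 < c₁ K₀ ∧ 0 < δ₁ K₀) ∧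
      ∀ K₀ : ℕ, K₀min ≤ K₀ →
      ∀ (P : HiggsLattice.Params) (_S : Shape P), P.d = d → P.L = L → K₀ ∣ P.M → 3 * K₀ ≤ 2 * P.M →
      ∀ {k : ℕ}, 1 ≤ k → k < P.K → P.mesh k ≤ 1 →
      ∀ {r : ℝ}, r * P.mesh k ≤ cA K₀ →
      ∀ A : HiggsLattice.VecField P k, (∀ x, ‖toSite A x‖ ≤ r) →
        ∀ (Λ : Finset (HiggsLattice.Site P k)) {p q : HiggsLattice.Site P k × Ix N}, p.1 ∈ Λ → q.1 ∈ Λ →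
          |mat (condCov232 C Finset.univ (bgVec mu0sq a k A) msq a k Λ) p q| ≤
              P.mesh k ^ 2 * c₁ K₀ * Real.exp (-(δ₁ K₀ * (HiggsLattice.Site.tdist p.1 q.1 : ℝ)))
          ∧ |mat (deltaCov235 C Finset.univ (bgVec mu0sq a k A) msq a k Λ) p q| ≤
              P.mesh k ^ 2 * c₁ K₀ * Real.exp (-(δ₁ K₀ *
                ((HiggsLattice.Site.tdist p.1 q.1 : ℝ) + distC Λ p.1 + distC Λ q.1))) := by
  obtain ⟨K₀min, cA, c₁, δ₁, hpos, h⟩ := ineq234_236_bgVec_torus d L hd hL ha hmu hmsq N C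
  exact ⟨K₀min, cA, c₁, δ₁, hpos, fun K₀ hK₀ P S hPd hPL hK₀M h3M k hk1 hk hs r hr A hA Λ p q hp hq =>
    h K₀ hK₀ P S hPd hPL hK₀M hk1 hk (three_half_le_sites hk.le h3M) hs hr A hA Λ hp hq⟩

end Background

end Literature.MathematicalPhysics.QuantumFieldTheory.Balaban1983to89.B1Ineq234BackgroundTorus

end
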